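import Summits.QuantumAdvantage.QuantumAdvantage.Theorems.CubicForrelationNearExactIsExactEightTypeOWindow
import Summits.QuantumAdvantage.QuantumAdvantage.Theorems.CubicForrelationNearExactIsExactEightFlatSums
import Summits.QuantumAdvantage.QuantumAdvantage.Theorems.CubicForrelationNearExactIsExactEightSymplectic
import Summits.QuantumAdvantage.QuantumAdvantage.Theorems.CubicForrelationNearExactIsExactQuadWalshPlateau
import Summits.QuantumAdvantage.QuantumAdvantage.Theorems.CubicForrelationNearExactIsExactTenZCount

/-!
# Crux `CubicForrelation.NearExactIsExact` (stmt-QuantumAdvantage-14043) — TYPE-O PAIRS ON 8 BITS CAP AT `13/16`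

Certificate seat `b2b-cforr-cert` (generation 2), rung `θ₈ = 13/16`.  HONEST FRAMING: a theorem about cubic Boolean functions on 8
bits (the finite slice `n = 8` of the crux) — NOT summit progress.

**Theorem (`typeO_pair_le_thirteen_sixteenths`).** If `f, g : 𝔽₂⁸ → 𝔽₂` are cubic and BOTH of type O (every Walsh value `8·odd`),
then `Φ(f,g) ≤ 13/16`.  (The other type — all Walsh values in `16ℤ` — is the companion file; together they give `θ₈ = 13/16`.)

Proof.  Assume `Φ > 13/16`, `W_g = 8u`.  By `…EightTypeOWindow`: `u = 2s + c + 8κ` with `s = (−1)^f`, `c = 2d₁ − 1`, `d₁ = [⌊u/2⌋ odd]`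
quadratic (`ed_digitOne`), `κ ∈ {0,±1}` non-zero at `m ≤ 2` points.  FOURIER (`eo_fourier`, inversion `û = 32(−1)^g`):
`W_{d₁}(y) = 2W_f(y) + 8K(y) − 32(−1)^{g(y)}` with `K(y) = Σ_x κ(x)(−1)^{x·y}`; as `f` is type O, `2W_f ≡ 16 (mod 32)`.
Dickson's plateau (`stub_quadWalshPlateau`): `W_{d₁} ∈ {0, ±2^s}` for one `s`; Parseval `Σ W_{d₁}² = 2¹⁶`.
* `m = 1`: `8K = ±8`, so every `W_{d₁}(y)` is `8·odd ≠ 0`, hence `256·4^s = 2¹⁶`, `W_{d₁}² = 256 = (8·odd)²` — impossible.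
* `m = 2` (`x₁ ≠ x₂`): `K(0) = κ₁ + κ₂` and `K(y*) = ±(κ₁ − κ₂)` for `y*` separating `x₁, x₂`; one is `0`, the other `±2`.  Where `K = 0`,
  `W_{d₁} = 16·odd ≠ 0` so `4^s = 256·odd²`, forcing `4^s = 256` (`eo_pow_four`); where `K = ±2`, `W_{d₁} ∈ 32ℤ ∩ {0, ±16} = {0}`; then
  `Σ W_{d₁}² ≤ 255·256 < 2¹⁶`.
* `m = 0`: every `W_{d₁}(y) = 16·odd ≠ 0`, so the symplectic extraction (`es_extract`, `es_flat_signsum`) yields a parametrised 4-flat with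
  `Σ_ε (−1)^{d₁} = ±4`; but there `Σ_ε u ≡ 0 (mod 8)` (`ed_flat_sum_four`) and `Σ_ε (−1)^f ∈ 4ℤ` (`ed_sum_signOf_flat`) give
  `Σ_ε c = Σ_ε u − 2Σ_ε s ∈ 8ℤ`, while `Σ_ε c = −Σ_ε (−1)^{d₁} = ∓4`.
(The disprove-g4 census found the type-O maximum `25/32`; `13/16` is what the rung needs.)

References: L. E. Dickson, *Linear Groups* (1901) Ch. VIII; C. Carlet, *Boolean Functions for Cryptography and Coding Theory*, CUP 2021,
§4.1, §5.2; S. Aaronson, A. Ambainis, *Forrelation*, SIAM J. Comput. 47 (2018) §1.1.1.  Everything below is proved from Mathlib and the tree;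
axioms are the standard three.
-/

set_option linter.dupNamespace false -- D-0017: single-problem summit ⇒ `QuantumAdvantage.QuantumAdvantage` by design

noncomputable section

namespace Summit.QuantumAdvantage.QuantumAdvantage.Theorems.CubicForrelation.NearExactIsExact

open Finset
open Literature.Computability.QuantumComplexity
open Literature.Computability.QuantumComplexity.BuzetChailloux (bxor zeroVec twist_zeroVec_right bxor_eq_zeroVec_iff signOf_sq)
open Literature.Computability.QuantumComplexity.DerivativeWalsh (W twist_bxor_left)

/-! ### Arithmetic helpers -/

/-- `(4:ℝ)^s = 256·(2j+1)²` forces `(2j+1)² = 1`. [folklore] -/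
theorem eo_pow_four (s : ℕ) (j : ℤ) (h : (4 : ℝ) ^ s = 256 * (2 * j + 1) ^ 2) : (2 * j + 1) ^ 2 = 1 := by
  have hZ : (4 : ℤ) ^ s = 256 * (2 * j + 1) ^ 2 := by exact_mod_cast h
  have hsq : (2 * j + 1) ^ 2 = 4 * (j ^ 2 + j) + 1 := by ring
  generalize hJ : j ^ 2 + j = J at hsq
  have hJ0 : 0 ≤ J := by nlinarith [sq_nonneg j, sq_nonneg (j + 1)]
  rw [hsq] at hZ ⊢
  rcases Nat.lt_or_ge s 4 with hs | hs
  · interval_cases s <;> omega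
  · obtain ⟨t, rfl⟩ := Nat.exists_eq_add_of_le hs
    rw [pow_add, show (4 : ℤ) ^ 4 = 256 by norm_num] at hZ
    rcases Nat.eq_zero_or_pos t with rfl | ht
    · norm_num at hZ; omega
    · obtain ⟨t', rfl⟩ := Nat.exists_eq_add_of_le ht
      rw [pow_add, pow_one] at hZ
      have hP : (4 : ℤ) * 4 ^ t' = 4 * J + 1 := by linarith
      generalize (4 : ℤ) ^ t' = P at hP
      omega

/-- `(8(2j+1))² ≠ 256`. [folklore] -/
theorem eo_sq_ne (j : ℤ) : (8 * (2 * (j : ℝ) + 1)) ^ 2 ≠ 256 := by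
  intro h
  have hZ : (8 * (2 * j + 1)) ^ 2 = (256 : ℤ) := by exact_mod_cast h
  have hsq : (8 * (2 * j + 1)) ^ 2 = 256 * (j ^ 2 + j) + 64 := by ring
  generalize j ^ 2 + j = J at hsq
  omega

/-- The residue sign `c = 2[⌊u/2⌋ odd] − 1` is minus the sign of the digit. [folklore] -/
theorem eo_c_cast (a : ℤ) : (((if Odd (a / 2) then (1 : ℤ) else -1) : ℤ) : ℝ) = -signOf (decide (Odd (a / 2))) := by
  by_cases h : Odd (a / 2) <;> simp [h, signOf]

/-! ### The Fourier identity -/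

/-- **Fourier identity in type O.** With `u = 2s + c + 8κ` (`W_g = 8u`): `W_{d₁}(y) = 2·W_f(y) + 8·Σ_x κ(x)(−1)^{x·y} − 32·(−1)^{g(y)}`,
where `d₁ = [⌊u/2⌋ odd]` (inversion `Σ_x u(x)(−1)^{x·y} = 32(−1)^{g(y)}`). [this work] -/
theorem eo_fourier (f g : (Fin (4 + 4) → Bool) → Bool) (u κ : (Fin (4 + 4) → Bool) → ℤ)
    (hu : ∀ x, W (fun y => signOf (g y)) x = (2 : ℝ) ^ 3 * (u x : ℝ))
    (hdec : ∀ x, u x = 2 * sZ (f x) + (if Odd (u x / 2) then 1 else -1) + 8 * κ x) (y : Fin (4 + 4) → Bool) :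
    W (fun x => signOf (decide (Odd (u x / 2)))) y =
      2 * W (fun x => signOf (f x)) y + 8 * (∑ x, (κ x : ℝ) * twist x y) - 32 * signOf (g y) := by
  have hinv := tz_inversion (fun y => signOf (g y)) y
  simp_rw [hu] at hinv
  have e : ∀ x, (2 : ℝ) ^ 3 * (u x : ℝ) * twist x y =
      16 * (signOf (f x) * twist x y) + (-8) * (signOf (decide (Odd (u x / 2))) * twist x y) +
        64 * ((κ x : ℝ) * twist x y) := by
    intro x
    have hx : (u x : ℝ) = 2 * (sZ (f x) : ℝ) + (((if Odd (u x / 2) then (1 : ℤ) else -1) : ℤ) : ℝ) + 8 * (κ x : ℝ) := by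
      exact_mod_cast hdec x
    rw [hx, tp_sZ_cast, eo_c_cast]
    ring
  rw [sum_congr rfl fun x _ => e x, sum_add_distrib, sum_add_distrib, ← mul_sum, ← mul_sum, ← mul_sum] at hinv
  unfold W
  norm_num at hinv ⊢
  linarith

/-! ### The three cases -/

/-- Case `m = 1` is impossible: all `W_{d₁}` are `8·odd`, so non-zero with square `256`. [this work] -/
theorem eo_case_one {V : (Fin (4 + 4) → Bool) → ℝ} (s : ℕ) (hs : ∀ y, V y = 0 ∨ V y ^ 2 = (4 : ℝ) ^ s)
    (hP : ∑ y, V y ^ 2 = (2 : ℝ) ^ 16) (hodd : ∀ y, ∃ j : ℤ, V y = 8 * (2 * j + 1)) : False := by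
  have hne : ∀ y, V y ≠ 0 := by
    intro y h
    obtain ⟨j, hj⟩ := hodd y
    rw [h] at hj
    have : (0 : ℤ) = 8 * (2 * j + 1) := by exact_mod_cast hj
    omega
  have hsq : ∀ y, V y ^ 2 = (4 : ℝ) ^ s := fun y => (hs y).resolve_left (hne y)
  rw [sum_congr rfl fun y _ => hsq y, sum_const, card_univ, Fintype.card_fun, Fintype.card_bool, Fintype.card_fin] at hP
  norm_num at hP
  obtain ⟨j, hj⟩ := hodd zeroVec
  have h256 : V zeroVec ^ 2 = 256 := by rw [hsq]; linarith
  rw [hj] at h256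
  exact eo_sq_ne j h256

/-- Case `m = 2` is impossible: a point with `W_{d₁} = 16·odd` and a point with `W_{d₁} ∈ 32ℤ` cannot coexist with the plateau and
Parseval. [this work] -/
theorem eo_case_two {V : (Fin (4 + 4) → Bool) → ℝ} (s : ℕ) (hs : ∀ y, V y = 0 ∨ V y ^ 2 = (4 : ℝ) ^ s)
    (hP : ∑ y, V y ^ 2 = (2 : ℝ) ^ 16) (yA yB : Fin (4 + 4) → Bool) (hA : ∃ j : ℤ, V yA = 16 * (2 * j + 1))
    (hB : ∃ j : ℤ, V yB = 32 * j) : False := by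
  obtain ⟨jA, hjA⟩ := hA
  obtain ⟨jB, hjB⟩ := hB
  have hAne : V yA ≠ 0 := by
    intro h; rw [h] at hjA
    have : (0 : ℤ) = 16 * (2 * jA + 1) := by exact_mod_cast hjA
    omega
  have h4s : (4 : ℝ) ^ s = 256 * (2 * jA + 1) ^ 2 := by
    rw [← (hs yA).resolve_left hAne, hjA]; ring
  have hone := eo_pow_four s jA h4s
  have hone' : ((2 * jA + 1 : ℤ) : ℝ) ^ 2 = 1 := by exact_mod_cast hone
  push_cast at hone'
  rw [hone', mul_one] at h4s
  -- the `32ℤ` point vanishes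
  have hB0 : V yB = 0 := by
    rcases hs yB with h | h
    · exact h
    · exfalso
      rw [hjB, h4s] at h
      have hZ : (32 * jB) ^ 2 = (256 : ℤ) := by exact_mod_cast h
      have : (32 * jB) ^ 2 = 1024 * jB ^ 2 := by ring
      rw [this] at hZ
      have hj2 : jB ^ 2 = 0 ∨ 1 ≤ jB ^ 2 := by
        rcases le_or_gt (jB ^ 2) 0 with h' | h'
        · left; nlinarith [sq_nonneg jB]
        · right; omega
      rcases hj2 with h0 | h1 <;> omega
  -- Parseval fails
  have hle : ∀ y ∈ univ.erase yB, V y ^ 2 ≤ 256 := by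
    intro y _
    rcases hs y with h | h
    · rw [h]; norm_num
    · rw [h, h4s]
  have hsum : ∑ y, V y ^ 2 ≤ 255 * 256 := by
    have h1 : ∑ y ∈ univ.erase yB, V y ^ 2 = ∑ y, V y ^ 2 := sum_erase univ (by rw [hB0]; ring)
    rw [← h1]
    calc ∑ y ∈ univ.erase yB, V y ^ 2 ≤ ∑ y ∈ univ.erase yB, (256 : ℝ) := sum_le_sum hle
      _ = 255 * 256 := by
        rw [sum_const, card_erase_of_mem (mem_univ _), card_univ, Fintype.card_fun, Fintype.card_bool, Fintype.card_fin]
        norm_num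
  rw [hP] at hsum
  norm_num at hsum

/-! ### The theorem -/

/-- **Type-O cubic pairs on 8 bits have `Φ ≤ 13/16`.** If `f, g : 𝔽₂⁸ → 𝔽₂` are cubic and every Walsh value of each is `8·odd`,
then `Φ(f,g) ≤ 13/16`.  Finite-slice theorem (n = 8); NOT summit progress. [this work] -/
theorem typeO_pair_le_thirteen_sixteenths (f g : (Fin (4 + 4) → Bool) → Bool) (hf : IsDegLeFun 3 f) (hg : IsDegLeFun 3 g)
    (hgO : ∀ x, ∃ k : ℤ, W (fun y => signOf (g y)) x = 8 * (2 * k + 1))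
    (hfO : ∀ y, ∃ k : ℤ, W (fun x => signOf (f x)) y = 8 * (2 * k + 1)) :
    forrelation f g ≤ 13 / 16 := by
  classical
  by_contra hΦ
  push Not at hΦ
  choose k hk using hgO
  choose k' hk' using hfO
  set u : (Fin (4 + 4) → Bool) → ℤ := fun x => 2 * k x + 1 with hudef
  have hu : ∀ x, W (fun y => signOf (g y)) x = (2 : ℝ) ^ 3 * (u x : ℝ) := by
    intro x; rw [hk x, hudef]; push_cast; ring
  have hodd : ∀ x, Odd (u x) := fun x => ⟨k x, rfl⟩
  obtain ⟨κ, hdec, hκ1, hκ2⟩ := eow_kappa f g hf hg u hu hodd hΦ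
  have hd1 : IsDegLeFun 2 (fun x => decide (Odd (u x / 2))) := ed_digitOne g u hg hu
  have hfour := eo_fourier f g u κ hu hdec
  obtain ⟨s, hs⟩ := stub_quadWalshPlateau (4 + 4) (fun x => decide (Odd (u x / 2))) hd1
  have hP := eow_parseval (fun x => decide (Odd (u x / 2)))
  have hsg : ∀ y, signOf (g y) = 1 ∨ signOf (g y) = -1 := fun y => by cases g y <;> simp [signOf]
  -- the support of κ
  set S := univ.filter (fun x => κ x ≠ 0) with hSdef
  have hK : ∀ y, ∑ x, (κ x : ℝ) * twist x y = ∑ x ∈ S, (κ x : ℝ) * twist x y := by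
    intro y
    refine (sum_subset (filter_subset _ _) fun x _ hx => ?_).symm
    have : κ x = 0 := by simpa [hSdef] using hx
    rw [this]; push_cast; ring
  have hm : #S = 0 ∨ #S = 1 ∨ #S = 2 := by omega
  rcases hm with h0 | h1 | h2
  · -- m = 0 : symplectic extraction against the flat sums
    have hκ0 : ∀ x, κ x = 0 := fun x => by
      by_contra h; have : x ∈ S := mem_filter.2 ⟨mem_univ _, h⟩
      rw [card_eq_zero.1 h0] at this; exact notMem_empty _ this
    have hWne : ∀ y, W (fun x => signOf (decide (Odd (u x / 2)))) y ≠ 0 := by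
      intro y hy
      rw [hfour y, hK y, card_eq_zero.1 h0, sum_empty, hk' y] at hy
      rcases hsg y with h | h <;> rw [h] at hy
      · have : (2 * (8 * (2 * k' y + 1)) + 8 * 0 - 32 * 1 : ℤ) = 0 := by exact_mod_cast hy
        omega
      · have : (2 * (8 * (2 * k' y + 1)) + 8 * 0 - 32 * (-1) : ℤ) = 0 := by exact_mod_cast hy
        omega
    obtain ⟨a₀, a₁, a₂, a₃, h01, h23, h02, h03, h12, h13⟩ :=
      es_extract (by norm_num) (fun x => decide (Odd (u x / 2))) hd1 hWne
    have hsgn := es_flat_signsum (fun x => decide (Odd (u x / 2))) hd1 a₀ a₁ a₂ a₃ h01 h23 h02 h03 h12 h13 zeroVec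
    have hfl := ed_flat_sum_four g u hg hu zeroVec ![a₀, a₁, a₂, a₃]
    obtain ⟨z, hz⟩ := ed_sum_signOf_flat f hf zeroVec ![a₀, a₁, a₂, a₃]
    -- sum the decomposition over the flat
    have hpt : ∀ x, ((u x : ℤ) : ℝ) = 2 * signOf (f x) - signOf (decide (Odd (u x / 2))) := by
      intro x
      have h1 : u x = 2 * sZ (f x) + (if Odd (u x / 2) then 1 else -1) := by
        have := hdec x; rw [hκ0 x] at this; linarith
      have h2 : ((u x : ℤ) : ℝ) = 2 * (sZ (f x) : ℝ) + (((if Odd (u x / 2) then (1 : ℤ) else -1) : ℤ) : ℝ) := by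
        exact_mod_cast h1
      rw [h2, tp_sZ_cast, eo_c_cast]; ring
    have hsumdec : ((∑ ε : Fin 4 → Bool, u (fun j => zeroVec j ^^
        decide (Odd #(univ.filter fun i => ε i && (![a₀, a₁, a₂, a₃] i) j))) : ℤ) : ℝ) =
        2 * (4 * z) - ∑ ε : Fin 4 → Bool, signOf (decide (Odd (u (fun j => zeroVec j ^^
          decide (Odd #(univ.filter fun i => ε i && (![a₀, a₁, a₂, a₃] i) j))) / 2))) := by
      rw [← hz, mul_sum, ← sum_sub_distrib]
      push_cast
      exact sum_congr rfl fun ε _ => hpt _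
    obtain ⟨t, ht⟩ := hfl
    rw [ht] at hsumdec
    rcases hsgn with h | h <;> rw [h] at hsumdec
    · have : (8 * t : ℤ) = 2 * (4 * z) - 4 := by exact_mod_cast hsumdec
      omega
    · have : (8 * t : ℤ) = 2 * (4 * z) - (-4) := by exact_mod_cast hsumdec
      omega
  · -- m = 1
    obtain ⟨x₁, hS⟩ := card_eq_one.1 h1
    have hκx : κ x₁ = 1 ∨ κ x₁ = -1 := by
      have : x₁ ∈ S := by rw [hS]; exact mem_singleton_self _
      have hne := (mem_filter.1 this).2
      rcases hκ1 x₁ with h | h | h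
      · exact absurd h hne
      · exact Or.inl h
      · exact Or.inr h
    refine eo_case_one s hs hP fun y => ?_
    rw [hfour y, hK y, hS, sum_singleton, hk' y]
    rcases hsg y with hg1 | hg1 <;> rcases hκx with hx | hx <;> rcases Simon.twist_eq_one_or x₁ y with ht | ht <;>
      rw [hg1, hx, ht] <;> push_cast
    · exact ⟨2 * k' y - 1, by push_cast; ring⟩
    · exact ⟨2 * k' y - 2, by push_cast; ring⟩
    · exact ⟨2 * k' y - 2, by push_cast; ring⟩
    · exact ⟨2 * k' y - 1, by push_cast; ring⟩
    · exact ⟨2 * k' y + 3, by push_cast; ring⟩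
    · exact ⟨2 * k' y + 2, by push_cast; ring⟩
    · exact ⟨2 * k' y + 2, by push_cast; ring⟩
    · exact ⟨2 * k' y + 3, by push_cast; ring⟩
  · -- m = 2
    obtain ⟨x₁, x₂, hne, hS⟩ := card_eq_two.1 h2
    have hmem : ∀ x, x ∈ S → (κ x = 1 ∨ κ x = -1) := by
      intro x hx
      have hne := (mem_filter.1 hx).2
      rcases hκ1 x with h | h | h
      · exact absurd h hne
      · exact Or.inl h
      · exact Or.inr h
    have hκ₁ := hmem x₁ (by rw [hS]; simp)
    have hκ₂ := hmem x₂ (by rw [hS]; simp)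
    have hKy : ∀ y, ∑ x, (κ x : ℝ) * twist x y = κ x₁ * twist x₁ y + κ x₂ * twist x₂ y := by
      intro y; rw [hK y, hS, sum_pair hne]
    -- a separating character
    obtain ⟨yS, hyS⟩ := es_exists_twist_neg (a := bxor x₁ x₂) (fun h => hne ((bxor_eq_zeroVec_iff x₁ x₂).1 h))
    rw [twist_bxor_left] at hyS
    have hW : ∀ y, W (fun x => signOf (decide (Odd (u x / 2)))) y =
        16 * (2 * k' y + 1) + 8 * (κ x₁ * twist x₁ y + κ x₂ * twist x₂ y) - 32 * signOf (g y) := by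
      intro y; rw [hfour y, hKy y, hk' y]; ring
    -- K(0) = κ₁ + κ₂, K(yS) = ± (κ₁ − κ₂): one vanishes, the other is ±2
    have ht1 := Simon.twist_eq_one_or x₁ yS
    rcases hκ₁ with h₁ | h₁ <;> rcases hκ₂ with h₂ | h₂
    · -- κ = (1,1): K(yS) = 0, K(0) = 2
      refine eo_case_two s hs hP yS zeroVec ?_ ?_
      · rw [hW, h₁, h₂]
        rcases hsg yS with hg1 | hg1 <;> rcases ht1 with ht | ht <;> rw [hg1]
        · exact ⟨k' yS - 1, by push_cast; nlinarith [hyS, ht]⟩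
        · exact ⟨k' yS - 1, by push_cast; nlinarith [hyS, ht]⟩
        · exact ⟨k' yS + 1, by push_cast; nlinarith [hyS, ht]⟩
        · exact ⟨k' yS + 1, by push_cast; nlinarith [hyS, ht]⟩
      · rw [hW, h₁, h₂, twist_zeroVec_right, twist_zeroVec_right]
        rcases hsg zeroVec with hg1 | hg1 <;> rw [hg1]
        · exact ⟨k' zeroVec, by push_cast; ring⟩
        · exact ⟨k' zeroVec + 2, by push_cast; ring⟩
    · -- κ = (1,−1): K(0) = 0, K(yS) = ±2
      refine eo_case_two s hs hP zeroVec yS ?_ ?_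
      · rw [hW, h₁, h₂, twist_zeroVec_right, twist_zeroVec_right]
        rcases hsg zeroVec with hg1 | hg1 <;> rw [hg1]
        · exact ⟨k' zeroVec - 1, by push_cast; ring⟩
        · exact ⟨k' zeroVec + 1, by push_cast; ring⟩
      · rw [hW, h₁, h₂]
        rcases hsg yS with hg1 | hg1 <;> rcases ht1 with ht | ht <;> rw [hg1]
        · exact ⟨k' yS, by push_cast; nlinarith [hyS, ht]⟩
        · exact ⟨k' yS - 1, by push_cast; nlinarith [hyS, ht]⟩
        · exact ⟨k' yS + 2, by push_cast; nlinarith [hyS, ht]⟩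
        · exact ⟨k' yS + 1, by push_cast; nlinarith [hyS, ht]⟩
    · -- κ = (−1,1)
      refine eo_case_two s hs hP zeroVec yS ?_ ?_
      · rw [hW, h₁, h₂, twist_zeroVec_right, twist_zeroVec_right]
        rcases hsg zeroVec with hg1 | hg1 <;> rw [hg1]
        · exact ⟨k' zeroVec - 1, by push_cast; ring⟩
        · exact ⟨k' zeroVec + 1, by push_cast; ring⟩
      · rw [hW, h₁, h₂]
        rcases hsg yS with hg1 | hg1 <;> rcases ht1 with ht | ht <;> rw [hg1]
        · exact ⟨k' yS - 1, by push_cast; nlinarith [hyS, ht]⟩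
        · exact ⟨k' yS, by push_cast; nlinarith [hyS, ht]⟩
        · exact ⟨k' yS + 1, by push_cast; nlinarith [hyS, ht]⟩
        · exact ⟨k' yS + 2, by push_cast; nlinarith [hyS, ht]⟩
    · -- κ = (−1,−1)
      refine eo_case_two s hs hP yS zeroVec ?_ ?_
      · rw [hW, h₁, h₂]
        rcases hsg yS with hg1 | hg1 <;> rcases ht1 with ht | ht <;> rw [hg1]
        · exact ⟨k' yS - 1, by push_cast; nlinarith [hyS, ht]⟩
        · exact ⟨k' yS - 1, by push_cast; nlinarith [hyS, ht]⟩
        · exact ⟨k' yS + 1, by push_cast; nlinarith [hyS, ht]⟩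
        · exact ⟨k' yS + 1, by push_cast; nlinarith [hyS, ht]⟩
      · rw [hW, h₁, h₂, twist_zeroVec_right, twist_zeroVec_right]
        rcases hsg zeroVec with hg1 | hg1 <;> rw [hg1]
        · exact ⟨k' zeroVec - 1, by push_cast; ring⟩
        · exact ⟨k' zeroVec + 1, by push_cast; ring⟩

end Summit.QuantumAdvantage.QuantumAdvantage.Theorems.CubicForrelation.NearExactIsExact

end
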